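import Mathlib
import HarnessLib
import Summits.HubbardSuperconductivity.HubbardSuperconductivity.Theorems.KLProgrammeH10TwoPointLimitSymbolProductSampled

/-!
# Route `KLProgramme` — VL child `KLRegimeVolumeLimitV17F2` (stmt-HubbardSuperconductivity-20440), closer MODEL file M2 «MISMATCH-SLICE», bracket (c),
# part 2b: CRUDE pointwise second differences of a sampled multiplier-type symbol `G(k₀² + e(p)²)·Z(p)` — in the time direction and along an
# arbitrary integer spatial step — from SUP data of the band (`‖De‖ ≤ K₁`, `‖D²e‖ ≤ K₂`) and of the factor (`|Z| ≤ z₀`, `‖DZ‖ ≤ z₁`, `‖D²Z‖ ≤ z₂`)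

Cell `gate-hubbard-kl`, seat hubbard-kl-k3c4-p2 (g11; UV / Matsubara all-U lane), ask «MISMATCH-SLICE» (= M2, bracket (c)) of the VL registrant
k3c4-p1 g11 (KL STATUS 2026-08-27 22:29Z).  Part 2a (`…SymbolIncrementLine`) bounds the sampled DIFFERENCE of a multiplier symbol between two
frames by the second differences of the DERIVED family `q ↦ G′(k₀² + e_t²)·(2e_t(e_K − e_{K″}))·Z` — a sampled symbol of p4's generic shape
`H(k₀² + e(p)²)·W(p)` with a smooth factor `W = 2e_t·v·Z` that is NOT an angular plateau (it carries the band increment `v`).  For the frame-defect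
bracket no tangency gain is wanted (every term is already `O(1/L)` through `v`), so this file gives the ISOTROPIC / crude twins of p4's
`…SymbolProductSampled` §2–§3, in which the factor enters through sup norms of its value and first two derivatives on `Fin 2 → ℝ`:

* `abs_deriv_line_factor_le` — first line derivative of `s ↦ W(k + s•w)` from `‖DW‖ ≤ z₁` (second: p4's `abs_iteratedDeriv_two_line_le`);
  the TIME direction needs only `|W| ≤ z₀` and is p4's `norm_fwdDiff_two_time_sampledSymbol_le` verbatim (cite it; not restated);
* **`norm_fwdDiff_two_space_sampledSymbol_le_crude`** — for an integer step `u` (`w = hₓu`), under the zone condition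
  (`Φ(k₀, hₓm) = 0` whenever `2|m_j| + 4|u_j| ≥ L` for some `j`):
  `‖Δ²_{(0,ū)} G̃(q)‖ ≤ ‖w‖²·( ((4g₂+2g₁)K₁²/Λ² + 2g₁K₂/Λ)·z₀ + 4g₁K₁/Λ·z₁ + g₀·z₂ )` for EVERY `q`.

Everything is proved; no definitions, no named facts; nothing about the model is asserted. [folklore]
-/

noncomputable section

namespace Summit.HubbardSuperconductivity.HubbardSuperconductivity.Theorems.TorusFourierL2

set_option linter.dupNamespace false -- summit = problem name (single-conjunct summit), D-0017

open Set Finset Filter Topology Literature.Probability.LatticeModels Literature.Analysis.Calculus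
open scoped Real

/-! ## §1 Line derivatives of a smooth factor from sup data -/

section Factor

variable {V : Type*} [NormedAddCommGroup V] [NormedSpace ℝ V]

/-- **First line derivative of a `C²` factor**: `|d/ds W(k + s•w)| ≤ z₁·‖w‖` if `‖DW‖ ≤ z₁`. [folklore] -/
theorem abs_deriv_line_factor_le {W : V → ℝ} (hW : ContDiff ℝ 2 W) {z₁ : ℝ} (hz₁ : ∀ p, ‖fderiv ℝ W p‖ ≤ z₁) (k w : V) (s : ℝ) :
    |deriv (fun s : ℝ => W (k + s • w)) s| ≤ z₁ * ‖w‖ := by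
  rw [deriv_line_eq_fderiv hW k w s, ← Real.norm_eq_abs]
  exact ((fderiv ℝ W (k + s • w)).le_opNorm w).trans (mul_le_mul_of_nonneg_right (hz₁ _) (norm_nonneg _))

end Factor

/-! ## §2 The sampled symbol: crude space second differences -/

section Sampled

variable {P L : ℕ} [NeZero P] [NeZero L]

/-- **Space direction, CRUDE (isotropic) form**: for an integer step `u` with `w = hₓu`, if the symbol vanishes at the momenta within two steps of
the zone seam (`Φ(k₀, hₓm) = 0` whenever `2|m_j| + 4|u_j| ≥ L` for some `j`), the band has `‖De‖ ≤ K₁`, `‖D²e‖ ≤ K₂` and the factor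
`|W| ≤ z₀`, `‖DW‖ ≤ z₁`, `‖D²W‖ ≤ z₂`, then for EVERY `q`
`‖Δ²_{(0,ū)} G̃(q)‖ ≤ ‖w‖²·( ((4g₂+2g₁)K₁²/Λ² + 2g₁K₂/Λ)·z₀ + 4g₁K₁/Λ·z₁ + g₀·z₂ )`.
[cite: BenfattoGiulianiMastropietro2006, §2.5 Lemma 2.2 (2.53)–(2.55)] -/
theorem norm_fwdDiff_two_space_sampledSymbol_le_crude {G : ℝ → ℝ} (hG : ContDiff ℝ 2 G) {Λ g₀ g₁ g₂ : ℝ} (hΛ : 0 < Λ)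
    (hg₁ : 0 ≤ g₁) (hg₂ : 0 ≤ g₂) (hG0 : ∀ u, |G u| ≤ g₀) (hG1 : ∀ u, |deriv G u| ≤ g₁ / Λ ^ 2)
    (hG2 : ∀ u, |iteratedDeriv 2 G u| ≤ g₂ / Λ ^ 4) (hGv : ∀ u, Λ ^ 2 < u → G u = 0)
    {e W : (Fin 2 → ℝ) → ℝ} (he : ContDiff ℝ 2 e) (hW : ContDiff ℝ 2 W)
    {K₁ K₂ : ℝ} (hK₁ : ∀ p, ‖fderiv ℝ e p‖ ≤ K₁) (hK₂ : ∀ p, ‖iteratedFDeriv ℝ 2 e p‖ ≤ K₂)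
    {z₀ z₁ z₂ : ℝ} (hW0 : ∀ p, |W p| ≤ z₀) (hW1 : ∀ p, ‖fderiv ℝ W p‖ ≤ z₁) (hW2 : ∀ p, ‖iteratedFDeriv ℝ 2 W p‖ ≤ z₂)
    (Φ : ℝ × (Fin 2 → ℝ) → ℂ) (hΦ : ∀ k₀ p, Φ (k₀, p) = ((G (k₀ ^ 2 + e p ^ 2) * W p : ℝ) : ℂ)) (a₀ h₀ hx : ℝ)
    (u : Fin 2 → ℤ)
    (hzone : ∀ (k₀ : ℝ) (m : Fin 2 → ℤ), (∃ j, (L : ℤ) ≤ 2 * |m j| + 2 * (2 : ℕ) * |u j|) → Φ (k₀, fun j => hx * (m j : ℝ)) = 0)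
    (Gs : TorusSite 1 P × TorusSite 2 L → ℂ)
    (hGs : ∀ q, Gs q = Φ (a₀ + h₀ * (((q.1 0).val : ℕ) : ℝ), fun j => hx * (((q.2 j).valMinAbs : ℤ) : ℝ)))
    (q : TorusSite 1 P × TorusSite 2 L) :
    ‖((fwdDiff ((0 : TorusSite 1 P), (fun j => ((u j : ℤ) : ZMod L))))^[2] Gs) q‖ ≤
      ‖(fun j => hx * (u j : ℝ))‖ ^ 2 *
        (((4 * g₂ + 2 * g₁) * K₁ ^ 2 / Λ ^ 2 + 2 * g₁ * K₂ / Λ) * z₀ + 4 * g₁ * K₁ / Λ * z₁ + g₀ * z₂) := by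
  -- the line through the sample point
  set k₀ : ℝ := a₀ + h₀ * (((q.1 0).val : ℕ) : ℝ) with hk₀
  set k : Fin 2 → ℝ := fun j => hx * (((q.2 j).valMinAbs : ℤ) : ℝ) with hk
  set w : Fin 2 → ℝ := fun j => hx * (u j : ℝ) with hw
  have hg₀ : 0 ≤ g₀ := (abs_nonneg _).trans (hG0 0)
  have hK10 : 0 ≤ K₁ := le_trans (norm_nonneg _) (hK₁ 0)
  have hK20 : 0 ≤ K₂ := le_trans (norm_nonneg _) (hK₂ 0)
  have hz00 : 0 ≤ z₀ := (abs_nonneg _).trans (hW0 0)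
  have hz10 : 0 ≤ z₁ := le_trans (norm_nonneg _) (hW1 0)
  have hz20 : 0 ≤ z₂ := le_trans (norm_nonneg _) (hW2 0)
  have hline : (fun s : ℝ => Φ (((k₀, k) : ℝ × (Fin 2 → ℝ)) + s • (((0 : ℝ), w) : ℝ × (Fin 2 → ℝ)))) =
      fun s => (((G (e (k + s • w) ^ 2 + k₀ ^ 2) * W (k + s • w) : ℝ)) : ℂ) := by
    funext s; rw [spaceLine_apply, hΦ, add_comm (k₀ ^ 2) (e (k + s • w) ^ 2)]
  have hreal : ContDiff ℝ 2 fun s : ℝ => G (e (k + s • w) ^ 2 + k₀ ^ 2) * W (k + s • w) :=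
    (hG.comp (contDiff_two_sq_add (contDiff_two_line he k w) _)).mul (contDiff_two_line hW k w)
  have hC : ContDiff ℝ 2 fun s : ℝ => Φ (((k₀, k) : ℝ × (Fin 2 → ℝ)) + s • (((0 : ℝ), w) : ℝ × (Fin 2 → ℝ))) := by
    rw [hline]; exact Complex.ofRealCLM.contDiff.comp hreal
  refine norm_fwdDiff_iter_space_apply_le Φ a₀ h₀ hx 2 Gs hGs u hzone q hC fun s _ => ?_
  rw [hline, norm_iteratedDeriv_ofReal_comp hreal]
  -- p4's pointwise line bound with the factor `s ↦ W(k + s•w)`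
  have h := abs_iteratedDeriv_two_symbol_spaceLine_le (Z := fun s : ℝ => W (k + s • w)) he hK₂ hG (contDiff_two_line hW k w)
    hΛ hg₁ hg₂ hG0 hG1 hG2 hGv (sq_nonneg k₀) k w s
  -- crude data along the line
  have hφ1 : |fderiv ℝ e (k + s • w) w| ≤ K₁ * ‖w‖ := by
    rw [← Real.norm_eq_abs]
    exact ((fderiv ℝ e (k + s • w)).le_opNorm w).trans (mul_le_mul_of_nonneg_right (hK₁ _) (norm_nonneg _))
  have hφ1sq : (fderiv ℝ e (k + s • w) w) ^ 2 ≤ (K₁ * ‖w‖) ^ 2 := by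
    have := hφ1
    rw [← sq_abs]
    exact pow_le_pow_left₀ (abs_nonneg _) this 2
  have hZ0 : |W (k + s • w)| ≤ z₀ := hW0 _
  have hZ1 : |deriv (fun s : ℝ => W (k + s • w)) s| ≤ z₁ * ‖w‖ := abs_deriv_line_factor_le hW hW1 k w s
  have hZ2 : |iteratedDeriv 2 (fun s : ℝ => W (k + s • w)) s| ≤ z₂ * ‖w‖ ^ 2 := abs_iteratedDeriv_two_line_le hW hW2 k w s
  calc _ ≤ ((4 * g₂ + 2 * g₁) * (fderiv ℝ e (k + s • w) w) ^ 2 / Λ ^ 2 + 2 * g₁ * (K₂ * ‖w‖ ^ 2) / Λ) * |W (k + s • w)| +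
        4 * g₁ * |fderiv ℝ e (k + s • w) w| / Λ * |deriv (fun s : ℝ => W (k + s • w)) s| +
        g₀ * |iteratedDeriv 2 (fun s : ℝ => W (k + s • w)) s| := h
    _ ≤ ((4 * g₂ + 2 * g₁) * (K₁ * ‖w‖) ^ 2 / Λ ^ 2 + 2 * g₁ * (K₂ * ‖w‖ ^ 2) / Λ) * z₀ +
        4 * g₁ * (K₁ * ‖w‖) / Λ * (z₁ * ‖w‖) + g₀ * (z₂ * ‖w‖ ^ 2) := by
        gcongr
    _ = ‖w‖ ^ 2 * (((4 * g₂ + 2 * g₁) * K₁ ^ 2 / Λ ^ 2 + 2 * g₁ * K₂ / Λ) * z₀ + 4 * g₁ * K₁ / Λ * z₁ + g₀ * z₂) := by ring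

end Sampled

end Summit.HubbardSuperconductivity.HubbardSuperconductivity.Theorems.TorusFourierL2

end
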